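import Mathlib

/-!
# Tier 3 (T3.2 / T3.5) — the principal units `1 + pℤ_p` are torsion-free for `p` odd

Kernel twin of one sentence of the endgame census of FINDING 2
(proofs/t3-p3/R2-PINNING-ADDENDUM-4.md §A21 (2): «the global units meet [the anticyclotomic
quotient of the principal units `U¹`] trivially (`u/ū` is a root of unity — Kronecker, kernel
`Tier3AdmissibleType.mul_unitsComplexConj_inv_mem_torsion` — and `1 + p𝒪_w` is torsion-free for
`p` odd)»), on the degree-one line where `𝒪_w = ℤ_p`:

* **lifting the exponent on `ℤ_p`** for an odd prime `p`, assembled from Mathlib's general-domain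
  pieces (`emultiplicity_pow_sub_pow_of_prime`, `emultiplicity_pow_prime_pow_sub_pow_prime_pow`)
  exactly as Mathlib assembles `Int.emultiplicity_pow_sub_pow` over `ℤ`:
  `v_p(x^n − y^n) = v_p(x − y) + v_p(n)` whenever `p ∣ x − y` and `p ∤ x`;
* hence `x ≡ 1 (mod p)`, `x^n = 1`, `n ≠ 0` force `x = 1`: **`1 + pℤ_p` is torsion-free** —
  equivalently, the only root of unity of `ℤ_p` congruent to `1` modulo `p` is `1`;
* tightness: for `p = 2` the statement FAILS (`−1 ∈ 1 + 2ℤ_2` and `(−1)^2 = 1`), so the page's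
  «`p` odd» is needed — the cell's `p`-choice list has `p` odd (S10008).

`import Mathlib` only; theorems only (no definition, no instance); no axiom beyond the standard
three.  Nothing here is about Hecke characters or class field theory.
-/

namespace Summit.Ventures.HodgeRepro.T3.PadicPrincipalUnits

section OddPrime

variable (p : ℕ) [hp : Fact p.Prime]

/-- A non-zero element of `ℤ_p` has finite `p`-multiplicity (`ℤ_p` is a discrete valuation ring
and `p` is prime in it). -/
theorem finiteMultiplicity_p_of_ne_zero {d : ℤ_[p]} (hd : d ≠ 0) :
    FiniteMultiplicity (p : ℤ_[p]) d :=
  FiniteMultiplicity.of_prime_left PadicInt.prime_p hd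

/-- **Lifting the exponent on `ℤ_p`, `p` odd**: if `p ∣ x − y` and `p ∤ x` then
`v_p(x ^ n − y ^ n) = v_p(x − y) + v_p(n)` (as `emultiplicity`, with `⊤` for `0`).
The proof is Mathlib's proof of `Int.emultiplicity_pow_sub_pow`, with `PadicInt.prime_p` in
place of `Nat.prime_iff_prime_int` and the norm characterisation of `p ∣ k` in `ℤ_p`. -/
theorem emultiplicity_pow_sub_pow (hp1 : Odd p) {x y : ℤ_[p]} (hxy : (p : ℤ_[p]) ∣ x - y)
    (hx : ¬ (p : ℤ_[p]) ∣ x) (n : ℕ) :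
    emultiplicity (p : ℤ_[p]) (x ^ n - y ^ n) =
      emultiplicity (p : ℤ_[p]) (x - y) + emultiplicity p n := by
  rcases n with - | n
  · simp only [emultiplicity_zero, add_top, pow_zero, sub_self]
  have h : FiniteMultiplicity p (n + 1) :=
    Nat.finiteMultiplicity_iff.mpr ⟨hp.out.ne_one, n.succ_pos⟩
  rcases emultiplicity_eq_coe.mp h.emultiplicity_eq_multiplicity with ⟨⟨k, hk⟩, hpn⟩
  conv_lhs => rw [hk, pow_mul, pow_mul]
  rw [emultiplicity_pow_sub_pow_of_prime PadicInt.prime_p,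
    emultiplicity_pow_prime_pow_sub_pow_prime_pow PadicInt.prime_p hp1 hxy hx,
    h.emultiplicity_eq_multiplicity]
  · rw [← geom_sum₂_mul]
    exact dvd_mul_of_dvd_right hxy _
  · exact fun h => hx (PadicInt.prime_p.dvd_of_dvd_pow h)
  · intro hk'
    rw [← PadicInt.norm_lt_one_iff_dvd, PadicInt.norm_natCast_lt_one_iff] at hk'
    obtain ⟨c, rfl⟩ := hk'
    refine hpn ⟨c, ?_⟩
    rwa [pow_succ, mul_assoc]

/-- `p` does not divide an element congruent to `1` modulo `p` (else `p ∣ 1`). -/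
theorem not_dvd_of_dvd_sub_one {x : ℤ_[p]} (hx : (p : ℤ_[p]) ∣ x - 1) : ¬ (p : ℤ_[p]) ∣ x := by
  intro hpx
  have h1 : (p : ℤ_[p]) ∣ 1 := by
    have := hpx.sub hx
    rwa [sub_sub_cancel] at this
  exact PadicInt.prime_p.not_unit (isUnit_of_dvd_one h1)

/-- **`1 + pℤ_p` is torsion-free for `p` odd**: `x ≡ 1 (mod p)` and `x ^ n = 1` with `n ≠ 0`
force `x = 1`.  (Lifting the exponent: `v_p(x^n − 1) = v_p(x − 1) + v_p(n)` is finite unless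
`x = 1`, but `x^n − 1 = 0` has `v_p = ⊤`.) -/
theorem eq_one_of_pow_eq_one (hp1 : Odd p) {x : ℤ_[p]} (hx : (p : ℤ_[p]) ∣ x - 1) {n : ℕ}
    (hn : n ≠ 0) (h : x ^ n = 1) : x = 1 := by
  by_contra hne
  have hd : x - 1 ≠ 0 := sub_ne_zero.mpr hne
  have key := emultiplicity_pow_sub_pow p hp1 hx (not_dvd_of_dvd_sub_one p hx) n
  rw [h, one_pow, sub_self, emultiplicity_zero] at key
  have h1 : emultiplicity (p : ℤ_[p]) (x - 1) ≠ ⊤ :=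
    finiteMultiplicity_iff_emultiplicity_ne_top.mp (finiteMultiplicity_p_of_ne_zero p hd)
  have h2 : emultiplicity p n ≠ ⊤ :=
    finiteMultiplicity_iff_emultiplicity_ne_top.mp
      (Nat.finiteMultiplicity_iff.mpr ⟨hp.out.ne_one, Nat.pos_of_ne_zero hn⟩)
  exact (WithTop.add_ne_top.mpr ⟨h1, h2⟩) key.symm

/-- The same for roots of unity: a unit `ζ` of `ℤ_p` with `ζ ^ n = 1` (`n ≠ 0`) and
`ζ ≡ 1 (mod p)` is `1` — the only root of unity in the principal units is `1` (`p` odd). -/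
theorem eq_one_of_mem_rootsOfUnity (hp1 : Odd p) {n : ℕ} (hn : n ≠ 0) {ζ : ℤ_[p]ˣ}
    (hζ : ζ ∈ rootsOfUnity n ℤ_[p]) (h1 : (p : ℤ_[p]) ∣ (ζ : ℤ_[p]) - 1) : ζ = 1 := by
  rw [mem_rootsOfUnity'] at hζ
  exact Units.ext (eq_one_of_pow_eq_one p hp1 h1 hn hζ)

/-- **No non-trivial `p`-power torsion in `1 + pℤ_p`** (`p` odd), the form the page uses for the
pro-`p` group `1 + 𝔓_w𝒪_w ≅ ℤ_p`: `x ≡ 1 (mod p)` and `x ^ (p ^ m) = 1` force `x = 1`. -/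
theorem eq_one_of_pow_prime_pow_eq_one (hp1 : Odd p) {x : ℤ_[p]} (hx : (p : ℤ_[p]) ∣ x - 1)
    (m : ℕ) (h : x ^ (p ^ m) = 1) : x = 1 :=
  eq_one_of_pow_eq_one p hp1 hx (pow_ne_zero m hp.out.ne_zero) h

end OddPrime

section TwoTightness

/-- **Tightness of «`p` odd»**: in `ℤ_2` the principal unit `−1 ≡ 1 (mod 2)` is a non-trivial
root of unity, `(−1) ^ 2 = 1` — the statement `eq_one_of_pow_eq_one` is false for `p = 2`. -/
theorem two_dvd_neg_one_sub_one_and_neg_one_sq_eq_one_and_neg_one_ne_one :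
    ((2 : ℤ_[2]) ∣ (-1 : ℤ_[2]) - 1) ∧ (-1 : ℤ_[2]) ^ 2 = 1 ∧ (-1 : ℤ_[2]) ≠ 1 :=
  ⟨⟨-1, by ring⟩, by ring, by norm_num⟩

end TwoTightness

end Summit.Ventures.HodgeRepro.T3.PadicPrincipalUnits

/-!
## v2 appendix (t3-p3 g7): Serre's Lemma, the iterate `(1 + p)^(pⁱ)`, and `U_1/U_{n+1}` generated by `1 + p`

The printed home of «`1 + pℤ_p ≅ ℤ_p` (`p` odd)» is Serre, *A Course in Arithmetic*, GTM 7,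
Chapter II §3.2, Proposition 8 (ADDENDUM-4 §A25).  Its elementary steps are on the kernel:

* **Serre's Lemma** (II §3.2: «Let `x ∈ U_n − U_{n+1}` with `n ≥ 1` if `p ≠ 2` … Then
  `x^p ∈ U_{n+1} − U_{n+2}`»), in valuation form: `v_p(x^p − 1) = v_p(x − 1) + 1` whenever
  `p ∣ x − 1` and `p` is odd (Mathlib's `emultiplicity_pow_prime_sub_pow_prime`), and statement-exact
  (`pow_prime_mem_sub_of_mem_sub`);
* **the iterate** `α = 1 + p` of the proof of Proposition 8: `v_p((1 + p)^(pⁱ) − 1) = i + 1`, i.e.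
  `(1 + p)^(pⁱ) ∈ U_{i+1} − U_{i+2}`; in congruence form `(1 + p)^(pⁿ) ≡ 1 (mod p^(n+1))` and
  `(1 + p)^(pⁿ) ≢ 1 (mod p^(n+2))`;
* **finite levels**: `U_1/U_{n+1}` is generated by the class of `1 + p` — every `x ≡ 1 (mod p)` is
  `≡ (1 + p)^k (mod p^(n+1))` for some `k < pⁿ` (Serre's «`U_1/U_n` … is a cyclic group, generated
  by `α_n`»); with `|U_1/U_{n+1}| = pⁿ` (the multiplicative twin of `index_span_pow_toAddSubgroup`
  of `Tier3UnramifiedCofinite` under Serre's `θ`) this is the cyclicity of `U_1/U_{n+1}`; the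
  passage to the limit `U_1 ≅ ℤ_p` stays on the page.

Still `import Mathlib` only, theorems only, standard axioms.
-/

namespace Summit.Ventures.HodgeRepro.T3.PadicPrincipalUnits

section SerreLemma

variable (p : ℕ) [hp : Fact p.Prime]

/-- **Serre's Lemma (II §3.2) in valuation form**, `p` odd: if `p ∣ x − 1` then
`v_p(x ^ p − 1) = v_p(x − 1) + 1` — so `x ∈ U_n − U_{n+1}` gives `x ^ p ∈ U_{n+1} − U_{n+2}`. -/
theorem emultiplicity_pow_prime_sub_one (hp1 : Odd p) {x : ℤ_[p]} (hx : (p : ℤ_[p]) ∣ x - 1) :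
    emultiplicity (p : ℤ_[p]) (x ^ p - 1) = emultiplicity (p : ℤ_[p]) (x - 1) + 1 := by
  have h := emultiplicity_pow_prime_sub_pow_prime PadicInt.prime_p hp1 hx
    (not_dvd_of_dvd_sub_one p hx)
  rwa [one_pow] at h

/-- **Serre's Lemma, statement-exact** (`p` odd, `n ≥ 1`; `U_m = 1 + p^m ℤ_p` written as
`x − 1 ∈ (p^m)`): `x ∈ U_n − U_{n+1}` ⇒ `x ^ p ∈ U_{n+1} − U_{n+2}`. -/
theorem pow_prime_mem_sub_of_mem_sub (hp1 : Odd p) {n : ℕ} (hn : 1 ≤ n) {x : ℤ_[p]}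
    (h1 : x - 1 ∈ Ideal.span {(p : ℤ_[p]) ^ n})
    (h2 : x - 1 ∉ Ideal.span {(p : ℤ_[p]) ^ (n + 1)}) :
    x ^ p - 1 ∈ Ideal.span {(p : ℤ_[p]) ^ (n + 1)} ∧
      x ^ p - 1 ∉ Ideal.span {(p : ℤ_[p]) ^ (n + 2)} := by
  rw [Ideal.mem_span_singleton] at h1 h2
  have hx : (p : ℤ_[p]) ∣ x - 1 := (dvd_pow_self _ (by omega)).trans h1
  have hmult : emultiplicity (p : ℤ_[p]) (x - 1) = n := emultiplicity_eq_coe.mpr ⟨h1, h2⟩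
  rw [Ideal.mem_span_singleton, Ideal.mem_span_singleton, pow_dvd_iff_le_emultiplicity,
    pow_dvd_iff_le_emultiplicity, emultiplicity_pow_prime_sub_one p hp1 hx, hmult]
  constructor
  · exact_mod_cast le_rfl
  · intro h
    have : (n + 2 : ℕ) ≤ n + 1 := by exact_mod_cast h
    omega

/-- `p ∣ (1 + p) − 1`. -/
theorem dvd_one_add_prime_sub_one : (p : ℤ_[p]) ∣ (1 + p : ℤ_[p]) - 1 := by
  rw [add_sub_cancel_left]

/-- `v_p((1 + p) − 1) = 1`. -/
theorem emultiplicity_one_add_prime_sub_one :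
    emultiplicity (p : ℤ_[p]) ((1 + p : ℤ_[p]) - 1) = 1 := by
  rw [add_sub_cancel_left]
  exact (finiteMultiplicity_p_of_ne_zero p PadicInt.prime_p.ne_zero).emultiplicity_self

/-- **The iterate of Serre's proof of Proposition 8** (`α = 1 + p`, `p` odd):
`v_p((1 + p) ^ (p ^ i) − 1) = i + 1`, i.e. `(1 + p) ^ (p ^ i) ∈ U_{i+1} − U_{i+2}`
(Mathlib's `emultiplicity_pow_prime_pow_sub_pow_prime_pow`). -/
theorem emultiplicity_one_add_prime_pow_sub_one (hp1 : Odd p) (i : ℕ) :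
    emultiplicity (p : ℤ_[p]) ((1 + p : ℤ_[p]) ^ (p ^ i) - 1) = i + 1 := by
  have h := emultiplicity_pow_prime_pow_sub_pow_prime_pow PadicInt.prime_p hp1
    (dvd_one_add_prime_sub_one p) (not_dvd_of_dvd_sub_one p (dvd_one_add_prime_sub_one p)) i
  rw [one_pow, emultiplicity_one_add_prime_sub_one] at h
  rw [h, add_comm]

/-- `(1 + p) ^ (p ^ n) ≡ 1 (mod p ^ (n + 1))`: the image of `1 + p` in `U_1 / U_{n+1}` has order
dividing `p ^ n`. -/
theorem one_add_prime_pow_pow_sub_one_mem_span (hp1 : Odd p) (n : ℕ) :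
    (1 + p : ℤ_[p]) ^ (p ^ n) - 1 ∈ Ideal.span {(p : ℤ_[p]) ^ (n + 1)} := by
  rw [Ideal.mem_span_singleton]
  apply pow_dvd_of_le_emultiplicity
  rw [emultiplicity_one_add_prime_pow_sub_one p hp1 n]
  exact_mod_cast le_rfl

/-- `(1 + p) ^ (p ^ n) ≢ 1 (mod p ^ (n + 2))`: with the previous theorem, the image of `1 + p` in
`U_1 / U_{n+2}` has order EXACTLY `p ^ (n + 1)` — Serre's «`(α_n)^{p^{n−2}} ≠ 1` and
`(α_n)^{p^{n−1}} = 1`». -/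
theorem one_add_prime_pow_pow_sub_one_not_mem_span (hp1 : Odd p) (n : ℕ) :
    (1 + p : ℤ_[p]) ^ (p ^ n) - 1 ∉ Ideal.span {(p : ℤ_[p]) ^ (n + 2)} := by
  rw [Ideal.mem_span_singleton]
  intro h
  have hle := le_emultiplicity_of_pow_dvd h
  rw [emultiplicity_one_add_prime_pow_sub_one p hp1 n] at hle
  have : (n + 2 : ℕ) ≤ n + 1 := by exact_mod_cast hle
  omega

end SerreLemma

section CyclicLevels

variable (p : ℕ) [hp : Fact p.Prime]

/-- An element of `ℤ_p` not divisible by `p` is a unit (its norm is `1`). -/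
theorem isUnit_of_not_dvd {z : ℤ_[p]} (hz : ¬ (p : ℤ_[p]) ∣ z) : IsUnit z := by
  rw [PadicInt.isUnit_iff]
  refine le_antisymm (PadicInt.norm_le_one z) (not_lt.mp ?_)
  rwa [PadicInt.norm_lt_one_iff_dvd]

/-- The binomial congruence `(1 + a) ^ j ≡ 1 + j a (mod p ^ (n + 2))` for `a = p ^ (n + 1) c`
(the terms of degree `≥ 2` in `a` are divisible by `p ^ (2n + 2)`). -/
theorem pow_one_add_congr (n j : ℕ) (c : ℤ_[p]) :
    (p : ℤ_[p]) ^ (n + 2) ∣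
      (1 + (p : ℤ_[p]) ^ (n + 1) * c) ^ j - (1 + (j : ℤ_[p]) * ((p : ℤ_[p]) ^ (n + 1) * c)) := by
  induction j with
  | zero => simp
  | succ j ih =>
    have key : (1 + (p : ℤ_[p]) ^ (n + 1) * c) ^ (j + 1)
        - (1 + ((j + 1 : ℕ) : ℤ_[p]) * ((p : ℤ_[p]) ^ (n + 1) * c))
        = ((1 + (p : ℤ_[p]) ^ (n + 1) * c) ^ j - (1 + (j : ℤ_[p]) * ((p : ℤ_[p]) ^ (n + 1) * c)))
            * (1 + (p : ℤ_[p]) ^ (n + 1) * c)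
          + (p : ℤ_[p]) ^ (n + 2) * ((j : ℤ_[p]) * c ^ 2 * (p : ℤ_[p]) ^ n) := by
      push_cast
      ring
    rw [key]
    exact dvd_add (dvd_mul_of_dvd_left ih _) (dvd_mul_right _ _)

/-- The iterate as an element: `(1 + p) ^ (p ^ n) = 1 + p ^ (n + 1) c` with `c` a UNIT (`p` odd) —
the two congruences of the previous section in one equation. -/
theorem exists_unit_one_add_prime_pow_pow (hp1 : Odd p) (n : ℕ) :
    ∃ c : ℤ_[p], (1 + p : ℤ_[p]) ^ (p ^ n) = 1 + (p : ℤ_[p]) ^ (n + 1) * c ∧ IsUnit c := by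
  obtain ⟨c, hc⟩ :=
    Ideal.mem_span_singleton.mp (one_add_prime_pow_pow_sub_one_mem_span p hp1 n)
  refine ⟨c, by rw [← hc]; ring, ?_⟩
  by_contra hcu
  have hpc : (p : ℤ_[p]) ∣ c := by
    by_contra h
    exact hcu (isUnit_of_not_dvd p h)
  apply one_add_prime_pow_pow_sub_one_not_mem_span p hp1 n
  rw [Ideal.mem_span_singleton, hc, pow_succ]
  exact mul_dvd_mul_left _ hpc

/-- **`U_1 / U_{n+1}` is generated by the class of `1 + p`** (`p` odd): every `x ≡ 1 (mod p)` is
`≡ (1 + p) ^ k (mod p ^ (n + 1))` for some `k`.  Induction on `n`: from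
`x = (1 + p)^k (1 + p^(n+1) e)` and `(1 + p)^(pⁿ) = 1 + p^(n+1) c` with `c` a unit, the exponent
`k + j pⁿ` with `j ≡ e / c (mod p)` (`PadicInt.appr`) works modulo `p ^ (n + 2)`. -/
theorem exists_pow_one_add_prime_dvd_sub (hp1 : Odd p) {x : ℤ_[p]} (hx : (p : ℤ_[p]) ∣ x - 1)
    (n : ℕ) : ∃ k : ℕ, (p : ℤ_[p]) ^ (n + 1) ∣ x - (1 + p : ℤ_[p]) ^ k := by
  induction n with
  | zero => exact ⟨0, by simpa using hx⟩
  | succ n ih =>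
    obtain ⟨k, d, hd⟩ := ih
    obtain ⟨c, hc, hcu⟩ := exists_unit_one_add_prime_pow_pow p hp1 n
    obtain ⟨cu, rfl⟩ := hcu
    have hu1 : IsUnit (1 + p : ℤ_[p]) :=
      isUnit_of_not_dvd p (not_dvd_of_dvd_sub_one p (dvd_one_add_prime_sub_one p))
    obtain ⟨u, hu⟩ := hu1.pow k
    set y : ℤ_[p] := d * ((u⁻¹ : ℤ_[p]ˣ) : ℤ_[p]) * ((cu⁻¹ : ℤ_[p]ˣ) : ℤ_[p]) with hy
    obtain ⟨s, hs⟩ := Ideal.mem_span_singleton.mp (PadicInt.appr_spec 1 y)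
    obtain ⟨R, hR⟩ := pow_one_add_congr p n (PadicInt.appr y 1) (cu : ℤ_[p])
    refine ⟨k + PadicInt.appr y 1 * p ^ n,
      (u : ℤ_[p]) * (cu : ℤ_[p]) * s - (u : ℤ_[p]) * R, ?_⟩
    rw [pow_add, pow_mul', hc, ← hu]
    rw [← hu] at hd
    have U1 : (u : ℤ_[p]) * ((u⁻¹ : ℤ_[p]ˣ) : ℤ_[p]) = 1 := Units.mul_inv u
    have U2 : (cu : ℤ_[p]) * ((cu⁻¹ : ℤ_[p]ˣ) : ℤ_[p]) = 1 := Units.mul_inv cu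
    rw [pow_one] at hs
    linear_combination hd - (u : ℤ_[p]) * hR
      + (p : ℤ_[p]) ^ (n + 1) * (u : ℤ_[p]) * (cu : ℤ_[p]) * hs
      - (p : ℤ_[p]) ^ (n + 1) * d * ((cu : ℤ_[p]) * ((cu⁻¹ : ℤ_[p]ˣ) : ℤ_[p])) * U1
      - (p : ℤ_[p]) ^ (n + 1) * d * U2

/-- The same with the exponent reduced: `k < p ^ n` (since `(1 + p) ^ (p ^ n) ≡ 1 (mod p ^ (n + 1))`)
— the `p ^ n` classes `(1 + p) ^ k`, `k < p ^ n`, exhaust `U_1 / U_{n+1}`. -/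
theorem exists_pow_one_add_prime_dvd_sub_lt (hp1 : Odd p) {x : ℤ_[p]} (hx : (p : ℤ_[p]) ∣ x - 1)
    (n : ℕ) : ∃ k : ℕ, k < p ^ n ∧ (p : ℤ_[p]) ^ (n + 1) ∣ x - (1 + p : ℤ_[p]) ^ k := by
  obtain ⟨k, hk⟩ := exists_pow_one_add_prime_dvd_sub p hp1 hx n
  have hpn : 0 < p ^ n := pow_pos hp.out.pos n
  have hkr : k = k % p ^ n + p ^ n * (k / p ^ n) := (Nat.mod_add_div k (p ^ n)).symm
  set r := k % p ^ n
  set q := k / p ^ n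
  refine ⟨r, Nat.mod_lt k hpn, ?_⟩
  have h1 : (p : ℤ_[p]) ^ (n + 1) ∣ (1 + p : ℤ_[p]) ^ k - (1 + p : ℤ_[p]) ^ r := by
    have hsplit : (1 + p : ℤ_[p]) ^ k - (1 + p : ℤ_[p]) ^ r
        = (1 + p : ℤ_[p]) ^ r * (((1 + p : ℤ_[p]) ^ (p ^ n)) ^ q - 1) := by
      have hk' : (1 + p : ℤ_[p]) ^ k = (1 + p : ℤ_[p]) ^ r * ((1 + p : ℤ_[p]) ^ (p ^ n)) ^ q := by
        rw [← pow_mul, ← pow_add, ← hkr]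
      rw [hk']
      ring
    rw [hsplit]
    apply dvd_mul_of_dvd_right
    exact (Ideal.mem_span_singleton.mp (one_add_prime_pow_pow_sub_one_mem_span p hp1 n)).trans
      (sub_one_dvd_pow_sub_one _ _)
  have := dvd_add hk h1
  rwa [sub_add_sub_cancel] at this

end CyclicLevels

end Summit.Ventures.HodgeRepro.T3.PadicPrincipalUnits
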